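import Summits.CriticalPhenomena.PercolationContinuityZ3.Theorems.FK.FiniteMeanRadiusPercolation
import HarnessLib

/-!
# Exponential-decay forms of Grimmett 2006, Lemma (6.28) on `ℤ²` — the shape in which Thm. (6.30)
# (Alexander's exponential decay) is consumed by Thm. (6.20)

Claimed R42 (8)(c) in the cell INBOX at 2026-08-27T23:34:37Z by fkp-10a gen 351 (NEW CLAIM #4 of the gen), addressed to coordinator fk-4 g261 (seated 19:52Z 2026-08-27; R142 l.8183, R143 l.8196, R144 l.8217); lineage row FO-10a-g351m (self-suggested), package g351-meanradius, label MR-C.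
Support file of the `fk-continuity` cell (lineage fkp-10a, `--supports stmt-CriticalPhenomena-4575`); builds on
p205010 (kernel theorem, internal audit signed; external expert review pending).  No definitions, no named facts,
no sorries; standard axioms.  `d = 2`, `q ≥ 1`.  Companion of `FiniteMeanRadiusPercolation.lean` (Lemma (6.28):
summable dual one-arm probabilities `⇒ θ > 0`).

* `summable_of_le_exp_neg_mul`, `summable_of_le_linear_mul_exp_neg_mul` — geometric domination
  (`f m ≤ e^{-αm}` for `m ≥ 1`, resp. `f n ≤ 2·2·(2n+1)^{2-1} e^{-nψ}`, the `d = 2` case of the boundary count of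
  (5.46), give `Σ f < ∞`);
* **`thetaFree_pos_of_wired_dual_exp_decay`**, **`thetaWired_pos_of_free_dual_exp_decay`** — for `0 < p ≤ 1`: if the
  radius law of the dual measure decays exponentially, `φ^{1-b}_{p_d,q}(0 ↔ ∂Λ_m) ≤ e^{-αm}` (`m ≥ 1`, some `α > 0`),
  then `θ^b(p,q) > 0`;
* `thetaFree_pos_of_wired_dual_twoPoint_exp_decay` — the same from exponential decay of an axis TWO-POINT function
  of the dual, `φ¹_{p_d,q}(0 ↔ m e_k) ≤ e^{-mψ}` (`ψ > 0`), via (5.46) `φ(0 ↔ ∂Λ_n) ≤ 4(2n+1) e^{-nψ}`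
  (`real_siteToBoundary_le_of_decayRate`: positive association, translation and lattice-symmetry invariance);
* `rcDualParam_lt_rcDualParam` — `p ↦ p_d` is strictly decreasing on `[0,1]`;
* **`rcCriticalProb_le_rcDualParam_of_wired_exp_decay_below`** — THE SHAPE OF THM. (6.20): if the wired radius law
  decays exponentially at EVERY parameter `0 ≤ p < p'` (`0 < p' ≤ 1`), then `p_c(q) ≤ (p')_d` (for `s > (p')_d`,
  `s_d < p'`, so `θ⁰(s,q) > 0` and `p_c(q) ≤ s`);
* `rcCriticalProb_eq_selfDual_of_wired_exp_decay_below_selfDual` — with `p' = p_sd(q)`: `p_c(q) = p_sd(q)`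
  (`(p_sd)_d = p_sd` and Thm. (6.17)(a));
* **`rcCriticalProb_le_of_wired_exp_decay_below_selfDual_pred`** — with `p' = p_sd(q-1) = √(q-1)/(1+√(q-1))`
  (`q ≥ 2`), the displayed hypothesis is exactly the conclusion of Thm. (6.30), and the conclusion is the printed
  bound of Thm. (6.20), `p_c(q) ≤ q/(q + √(q-1))` (`= √q/(√(1-q⁻¹)+√q)`, `rcDualParam_selfDual_pred`).

What is NOT here: Thm. (6.30) itself (the comparison with the Ising model in a field, [15] = Alexander) — it stays the
displayed hypothesis; hence no unconditional numerical bound on `p_c(q)` is claimed.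

## References

* G. Grimmett, *The Random-Cluster Model*, Springer 2006, §6.2 Lemma (6.28), Thm. (6.20) and its proof (p. 138),
  §6.3 Thm. (6.30); §5.4 eq. (5.46). [Grimmett2006]
* G. Grimmett, *Percolation*, 2nd ed., Springer 1999, §6.2–6.3. [GrimmettPercolation1999]
-/

noncomputable section

open scoped Classical Topology ENNReal
open MeasureTheory Filter Set

namespace Summit.CriticalPhenomena.PercolationContinuityZ3.Theorems.FK

open Literature.Probability.Percolation Literature.Probability.LatticeModels Literature.Barriers.CriticalPhenomena

variable {p p' q : ℝ}

/-- Geometric domination: a nonnegative sequence with `f m ≤ e^{-αm}` for `m ≥ 1` (`α > 0`) is summable.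
[folklore] -/
theorem summable_of_le_exp_neg_mul {f : ℕ → ℝ} {α : ℝ} (hα : 0 < α) (h0 : ∀ m, 0 ≤ f m)
    (h : ∀ m : ℕ, 1 ≤ m → f m ≤ Real.exp (-(α * m))) : Summable f := by
  have hr0 : 0 < Real.exp (-α) := Real.exp_pos _
  have hr1 : Real.exp (-α) < 1 := (Real.exp_lt_exp.2 (show -α < 0 by linarith)).trans_eq Real.exp_zero
  refine (summable_geometric_of_lt_one hr0.le hr1).of_norm_bounded_eventually_nat ?_
  filter_upwards [eventually_ge_atTop 1] with m hm
  rw [Real.norm_of_nonneg (h0 m)]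
  refine (h m hm).trans_eq ?_
  rw [← Real.exp_nat_mul]
  congr 1
  ring

/-- Linear-times-geometric domination in the shape of (5.46) for `d = 2`: a nonnegative sequence with
`f n ≤ 2·2·(2n+1)^{2-1} e^{-nψ}` (`ψ > 0`) is summable. [folklore] -/
theorem summable_of_le_linear_mul_exp_neg_mul {f : ℕ → ℝ} {ψ : ℝ} (hψ : 0 < ψ) (h0 : ∀ n, 0 ≤ f n)
    (h : ∀ n : ℕ, f n ≤ 2 * ((2 : ℕ) : ℝ) * (2 * (n : ℝ) + 1) ^ (2 - 1) * Real.exp (-(n * ψ))) :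
    Summable f := by
  have hr0 : 0 < Real.exp (-ψ) := Real.exp_pos _
  have hr1 : Real.exp (-ψ) < 1 := (Real.exp_lt_exp.2 (show -ψ < 0 by linarith)).trans_eq Real.exp_zero
  have hnr : ‖Real.exp (-ψ)‖ < 1 := by rwa [Real.norm_of_nonneg hr0.le]
  have h1 : Summable fun n : ℕ => (n : ℝ) ^ 1 * Real.exp (-ψ) ^ n :=
    summable_pow_mul_geometric_of_norm_lt_one 1 hnr
  have h2 : Summable fun n : ℕ => Real.exp (-ψ) ^ n := summable_geometric_of_lt_one hr0.le hr1
  have hg : Summable fun n : ℕ => 4 * (2 * (n : ℝ) + 1) * Real.exp (-ψ) ^ n := by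
    have : (fun n : ℕ => 4 * (2 * (n : ℝ) + 1) * Real.exp (-ψ) ^ n) =
        fun n : ℕ => 8 * ((n : ℝ) ^ 1 * Real.exp (-ψ) ^ n) + 4 * Real.exp (-ψ) ^ n := by
      funext n; ring
    rw [this]
    exact (h1.mul_left _).add (h2.mul_left _)
  refine hg.of_norm_bounded_eventually_nat (Eventually.of_forall fun n => ?_)
  rw [Real.norm_of_nonneg (h0 n)]
  refine (h n).trans_eq ?_
  have he : Real.exp (-(n * ψ)) = Real.exp (-ψ) ^ n := by
    rw [← Real.exp_nat_mul]
    congr 1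
    ring
  rw [he]
  norm_num

/-- **Lemma (6.28), exponential-decay form, `b = 0`**: for `0 < p ≤ 1`, `q ≥ 1`, if the radius law of the WIRED
measure at the dual parameter decays exponentially — `φ¹_{p_d,q}(0 ↔ ∂Λ_m) ≤ e^{-αm}` for `m ≥ 1`, some `α > 0`
(finite mean radius a fortiori) — then `θ⁰(p,q) > 0`. [cite: Grimmett2006, §6.2 Lemma (6.28); proof of Thm. (6.20)] -/
theorem thetaFree_pos_of_wired_dual_exp_decay (hp : p ∈ Set.Ioc (0 : ℝ) 1) (hq : 1 ≤ q)
    (hdec : ∃ α : ℝ, 0 < α ∧ ∀ m : ℕ, 1 ≤ m →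
      (rcLimit 2 true (rcDualParam p q) q).real (siteToBoundary 2 m) ≤ Real.exp (-(α * m))) :
    0 < thetaFree 2 p q := by
  obtain ⟨α, hα, h⟩ := hdec
  exact thetaFree_pos_of_summable_dual hp hq (summable_of_le_exp_neg_mul hα (fun _ => measureReal_nonneg) h)

/-- **Lemma (6.28), exponential-decay form, `b = 1`**: for `0 < p ≤ 1`, `q ≥ 1`, if
`φ⁰_{p_d,q}(0 ↔ ∂Λ_m) ≤ e^{-αm}` for `m ≥ 1` (some `α > 0`), then `θ¹(p,q) > 0`.
[cite: Grimmett2006, §6.2 Lemma (6.28)] -/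
theorem thetaWired_pos_of_free_dual_exp_decay (hp : p ∈ Set.Ioc (0 : ℝ) 1) (hq : 1 ≤ q)
    (hdec : ∃ α : ℝ, 0 < α ∧ ∀ m : ℕ, 1 ≤ m →
      (rcLimit 2 false (rcDualParam p q) q).real (siteToBoundary 2 m) ≤ Real.exp (-(α * m))) :
    0 < thetaWired 2 p q := by
  obtain ⟨α, hα, h⟩ := hdec
  exact thetaWired_pos_of_summable_dual hp hq (summable_of_le_exp_neg_mul hα (fun _ => measureReal_nonneg) h)

/-- **Positive inverse correlation length of the dual forces percolation** (two-point form of Lemma (6.28)): for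
`0 < p ≤ 1`, `q ≥ 1`, an axis `k` and `ψ > 0` with `φ¹_{p_d,q}(0 ↔ m e_k) ≤ e^{-mψ}` for all `m`, one has
`θ⁰(p,q) > 0` — by (5.46), `φ¹_{p_d,q}(0 ↔ ∂Λ_n) ≤ 4(2n+1)e^{-nψ}` (reflection argument: positive association,
translation and lattice-symmetry invariance of the box limit), which is summable.
[cite: Grimmett2006, §6.2 Lemma (6.28), §5.4 eq. (5.46)] -/
theorem thetaFree_pos_of_wired_dual_twoPoint_exp_decay (hp : p ∈ Set.Ioc (0 : ℝ) 1) (hq : 1 ≤ q) (k : Fin 2)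
    (hdec : ∃ ψ : ℝ, 0 < ψ ∧ ∀ m : ℕ, (rcLimit 2 true (rcDualParam p q) q).real
        (openConn (0 : Site 2) (m • (Pi.single k (1 : ℤ) : Site 2))) ≤ Real.exp (-(m * ψ))) :
    0 < thetaFree 2 p q := by
  obtain ⟨ψ, hψ, h⟩ := hdec
  have hp' : p ∈ Set.Icc (0 : ℝ) 1 := ⟨hp.1.le, hp.2⟩
  have hq0 : 0 < q := one_pos.trans_le hq
  have hd : rcDualParam p q ∈ Set.Icc (0 : ℝ) 1 := rcDualParam_mem_Icc hp' hq0
  have hP := isBoxLimit_rcLimit (d := 2) true hd hq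
  haveI := hP.isProbabilityMeasure
  have hb := real_siteToBoundary_le_of_decayRate (μ := rcLimit 2 true (rcDualParam p q) q)
    (hP.isPositivelyAssociated hd hq) (hP.measurePreserving_relabel_shift hd hq)
    (hP.measurePreserving_relabel_signedPerm hd hq0) k h
  exact thetaFree_pos_of_summable_dual hp hq
    (summable_of_le_linear_mul_exp_neg_mul hψ (fun _ => measureReal_nonneg) hb)

/-- The dual parameter `p ↦ p_d = q(1-p)/(p + q(1-p))` is strictly decreasing on `[0,1]` (`q > 0`).
[cite: Grimmett2006, §6.1 eq. (6.5)] -/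
theorem rcDualParam_lt_rcDualParam {a b : ℝ} (ha : a ∈ Set.Icc (0 : ℝ) 1) (hb : b ∈ Set.Icc (0 : ℝ) 1)
    (hab : a < b) (hq : 0 < q) : rcDualParam b q < rcDualParam a q := by
  unfold rcDualParam
  have hda := rcDual_denom_pos ha hq
  have hdb := rcDual_denom_pos hb hq
  rw [div_lt_div_iff₀ hdb hda]
  nlinarith [mul_pos hq (mul_pos hq (sub_pos.2 hab)), ha.1, hb.2]

/-- **The shape of Grimmett 2006, Thm. (6.20)**: let `0 < p' ≤ 1`, `q ≥ 1`; if the radius law of the WIRED measure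
decays exponentially at every parameter below `p'` — for every `0 ≤ p < p'` some `α > 0` with
`φ¹_{p,q}(0 ↔ ∂Λ_m) ≤ e^{-αm}`, `m ≥ 1` — then `p_c(q) ≤ (p')_d`: for `s > (p')_d`, `s_d < p'`, so `θ⁰(s,q) > 0` by
Lemma (6.28) and `p_c(q) ≤ s`. [cite: Grimmett2006, §6.2, proof of Thm. (6.20) (p. 138)] -/
theorem rcCriticalProb_le_rcDualParam_of_wired_exp_decay_below (hp' : p' ∈ Set.Ioc (0 : ℝ) 1) (hq : 1 ≤ q)
    (hdec : ∀ p : ℝ, 0 ≤ p → p < p' → ∃ α : ℝ, 0 < α ∧ ∀ m : ℕ, 1 ≤ m →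
      (rcLimit 2 true p q).real (siteToBoundary 2 m) ≤ Real.exp (-(α * m))) :
    rcCriticalProb 2 q ≤ rcDualParam p' q := by
  have hq0 : 0 < q := one_pos.trans_le hq
  have hp'' : p' ∈ Set.Icc (0 : ℝ) 1 := ⟨hp'.1.le, hp'.2⟩
  have hd : rcDualParam p' q ∈ Set.Icc (0 : ℝ) 1 := rcDualParam_mem_Icc hp'' hq0
  refine le_of_forall_gt_imp_ge_of_dense fun s hs => ?_
  have h0s : 0 < s := hd.1.trans_lt hs
  by_cases hs1 : s ≤ 1
  · have hsI : s ∈ Set.Icc (0 : ℝ) 1 := ⟨h0s.le, hs1⟩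
    have hlt : rcDualParam s q < p' := by
      have h := rcDualParam_lt_rcDualParam (q := q) hd hsI hs hq0
      rwa [rcDualParam_rcDualParam hp'' hq0] at h
    have hpos := thetaFree_pos_of_wired_dual_exp_decay (p := s) ⟨h0s, hs1⟩ hq
      (hdec _ (rcDualParam_mem_Icc hsI hq0).1 hlt)
    exact rcCriticalProb_le_of_thetaWired_pos hq hsI (hpos.trans_le (thetaFree_le_thetaWired hsI hq))
  · exact (rcCriticalProb_mem_Icc 2 q).2.trans (le_of_lt (not_le.1 hs1))

/-- **`p_c(q) = p_sd(q)` under exponential decay of the wired radius law below the self-dual point**: if for every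
`0 ≤ p < p_sd(q) = √q/(1+√q)` there is `α > 0` with `φ¹_{p,q}(0 ↔ ∂Λ_m) ≤ e^{-αm}` (`m ≥ 1`), then
`p_c(q) = √q/(1+√q)` (`q ≥ 1`; `(p_sd)_d = p_sd`, and `p_c ≥ p_sd` is Thm. (6.17)(a)).
[cite: Grimmett2006, §6.2 Lemma (6.28), Thm. (6.17)(a)] -/
theorem rcCriticalProb_eq_selfDual_of_wired_exp_decay_below_selfDual (hq : 1 ≤ q)
    (hdec : ∀ p : ℝ, 0 ≤ p → p < Real.sqrt q / (1 + Real.sqrt q) → ∃ α : ℝ, 0 < α ∧ ∀ m : ℕ, 1 ≤ m →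
      (rcLimit 2 true p q).real (siteToBoundary 2 m) ≤ Real.exp (-(α * m))) :
    rcCriticalProb 2 q = Real.sqrt q / (1 + Real.sqrt q) := by
  have hq0 : 0 ≤ q := zero_le_one.trans hq
  have hs : 0 < Real.sqrt q := Real.sqrt_pos.2 (one_pos.trans_le hq)
  have hsd : Real.sqrt q / (1 + Real.sqrt q) ∈ Set.Ioc (0 : ℝ) 1 :=
    ⟨by positivity, by rw [div_le_one (by positivity)]; linarith⟩
  refine le_antisymm ?_ (selfDual_le_rcCriticalProb hq)
  have h := rcCriticalProb_le_rcDualParam_of_wired_exp_decay_below hsd hq hdec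
  rwa [rcDualParam_sqrt_div hq0] at h

/-- The dual of `p_sd(q-1) = √(q-1)/(1+√(q-1))` at weight `q` is `q/(q + √(q-1))` (`q ≥ 1`) — the right-hand side
of Thm. (6.20), printed there as `√q/(√(1-q⁻¹)+√q)`. [cite: Grimmett2006, §6.2, proof of Thm. (6.20)] -/
theorem rcDualParam_selfDual_pred (hq : 1 ≤ q) :
    rcDualParam (Real.sqrt (q - 1) / (1 + Real.sqrt (q - 1))) q = q / (q + Real.sqrt (q - 1)) := by
  have hs : 0 ≤ Real.sqrt (q - 1) := Real.sqrt_nonneg _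
  have h1 : (0 : ℝ) < 1 + Real.sqrt (q - 1) := by positivity
  have hq0 : 0 < q := one_pos.trans_le hq
  have h2 : 0 < q + Real.sqrt (q - 1) := by positivity
  unfold rcDualParam
  rw [div_eq_div_iff (ne_of_gt (by
    have : 0 < Real.sqrt (q - 1) / (1 + Real.sqrt (q - 1)) + q * (1 - Real.sqrt (q - 1) / (1 + Real.sqrt (q - 1))) :=
      rcDual_denom_pos ⟨by positivity, by rw [div_le_one h1]; linarith⟩ hq0
    exact this)) h2.ne']
  field_simp
  ring

/-- **Grimmett 2006, Thm. (6.20), modulo Thm. (6.30)**: let `q ≥ 2`; if — as Thm. (6.30) (Alexander) asserts — for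
every `0 ≤ p < p_sd(q-1) = √(q-1)/(1+√(q-1))` the wired radius law decays exponentially,
`φ¹_{p,q}(0 ↔ ∂Λ_m) ≤ e^{-αm}` (`m ≥ 1`, some `α = α(p,q) > 0`), then
`p_c(q) ≤ (p_sd(q-1))_d = q/(q + √(q-1)) = √q/(√(1-q⁻¹)+√q)`.  The decay hypothesis is displayed, NOT proved
here. [cite: Grimmett2006, §6.2 Thm. (6.20) with its proof (p. 138); §6.3 Thm. (6.30)] -/
theorem rcCriticalProb_le_of_wired_exp_decay_below_selfDual_pred (hq : 2 ≤ q)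
    (h630 : ∀ p : ℝ, 0 ≤ p → p < Real.sqrt (q - 1) / (1 + Real.sqrt (q - 1)) → ∃ α : ℝ, 0 < α ∧ ∀ m : ℕ, 1 ≤ m →
      (rcLimit 2 true p q).real (siteToBoundary 2 m) ≤ Real.exp (-(α * m))) :
    rcCriticalProb 2 q ≤ q / (q + Real.sqrt (q - 1)) := by
  have hq1 : 1 ≤ q := one_le_two.trans hq
  have hs : 0 < Real.sqrt (q - 1) := Real.sqrt_pos.2 (by linarith)
  have hsd : Real.sqrt (q - 1) / (1 + Real.sqrt (q - 1)) ∈ Set.Ioc (0 : ℝ) 1 :=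
    ⟨by positivity, by rw [div_le_one (by positivity)]; linarith⟩
  rw [← rcDualParam_selfDual_pred hq1]
  exact rcCriticalProb_le_rcDualParam_of_wired_exp_decay_below hsd hq1 h630

end Summit.CriticalPhenomena.PercolationContinuityZ3.Theorems.FK

end
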